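import Literature.NumberTheory.Automorphic.GLnUnramifiedLFactorDivisibility
import HarnessLib

/-!
# The unramified local Hecke integral of `GL₂` over `Fˣ`: absolute convergence and value
# (Jacquet–Langlands (1970), Prop. 3.5: `Ψ(s, W°) = ∫_{Fˣ} W°(diag(a,1)) |a|^{s-1/2} d×a = L(s, π)` up to `vol(𝒪ˣ) W°(1)`)

Topic `NumberTheory/Automorphic`; namespace `Literature.NumberTheory.Automorphic`. Theorems only (no
definition, no named fact, no instance). The `Fˣ`-integral form, for an ARBITRARY Haar measure `μ'` of
`Fˣ`, of the unramified computation `rsZeta_spherical_glOneRep_eq` / `rsZeta_spherical_trivial_eq_gl`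
(which are phrased for the JPSS zeta integral over `GL₁(F) ⧸ U₁` and a transported measure), together with
the ABSOLUTE CONVERGENCE of the integral in the same half-plane — the two local inputs at the good places
of the Euler factorisation of the global Hecke integral of a pure tensor
(`integral_heckeIntegrand_pureTensor_eq_mul_tprod`, `HeckeIntegralPureTensorEuler`, hypothesis `hunr`).

Let `F` be a non-archimedean local field with `q = #𝓀_F`, `π` a representation of `GL₂(F)` on `V`,
`v ∈ V^{GL₂(𝒪)}` a Hecke eigenvector with the eigenvalues of the multiset `α`
(`T_r v = q^{r(2-r)/2} e_r(α) v`, `r = 1, 2`), `Λ` a `ψ`-Whittaker functional with `ψ` of conductor `𝒪`,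
`W°(g) = Λ(π(g) v)` (`whittakerModel π Λ v`), and `s ∈ ℂ` with `|a q^{-s}| < 1` for all `a ∈ α`.

* `integrable_units_of_shell` — a strongly measurable `f : Fˣ → ℂ` vanishing on `|a| > 1`, constant `= w_m`
  on the shell `|a| = q^{-m}` (`m ∈ ℕ`) with `∑ ‖w_m‖ < ∞` is integrable for every left-invariant measure
  finite on compacts (`∫ ‖f‖ ≤ μ'(𝒪ˣ) ∑ ‖w_m‖`; companion of `integral_units_eq_tsum_shell`);
* `hasSum_whittakerModel_diagGL2_pow` — the torus generating series
  `∑_m W°(diag(ϖ^m,1)) (q^{1/2} q^{-s})^m = Λ(v) / ∏_{a ∈ α} (1 - a q^{-s})`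
  (`hasSum_whittakerModel_cornerTorus` at `(n, m) = (2, 1)` against the trivial representation of `GL₁`:
  Shintani's formula `W°(diag(ϖ^m,1)) = q^{-m/2} h_m(α) Λ(v)` summed with Cauchy's identity);
* `integrable_whittakerModel_diagGL2_mul_cpow` — **absolute convergence**:
  `a ↦ W°(diag(a,1)) |a|^{s-1/2}` is `μ'`-integrable on `Fˣ`;
* `integral_whittakerModel_diagGL2_mul_cpow_eq` — **the unramified computation**:

    `∫_{Fˣ} W°(diag(a,1)) |a|^{s-1/2} dμ'(a) = μ'(𝒪ˣ) · Λ(v) · (∏_{a ∈ α} (1 - a q^{-s}))⁻¹`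

  (Jacquet–Langlands (1970), Prop. 3.5: `Φ(s, W°) = L(s, π)` for `W°` normalised by `W°(1) = 1` and
  `vol(𝒪ˣ) = 1`; Bump (1997), Prop. 4.6.5 and (7.3); Cogdell (2004), Thm. 3.3 for `(n, m) = (2, 1)`).

## References

* H. Jacquet, R. P. Langlands, *Automorphic Forms on GL(2)*, LNM 114 (1970), Prop. 3.5 [JacquetLanglands1970].
* D. Bump, *Automorphic Forms and Representations* (1997), Prop. 4.6.5, §3.5 (7.3).
* J. W. Cogdell, *Lectures on L-functions, converse theorems, and functoriality for GL_n* (2004), Thm. 3.3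
  [CogdellAnalyticTheory2004].
* T. Shintani, *On an explicit formula for class-1 "Whittaker functions" on GL_n over P-adic fields*,
  Proc. Japan Acad. 52 (1976) [Shintani1976].
-/

noncomputable section

open scoped MatrixGroups NNReal ENNReal
open MeasureTheory ValuativeRel Polynomial Filter Finset
  Literature.NumberTheory.GaloisRepresentations.IsNonarchimedeanLocalField
  Literature.NumberTheory.EllipticCurves.Hida2000Thm326

namespace Literature.NumberTheory.Automorphic

/-! ### 1. Integrability of shell-constant functions -/

section Shell

variable {F : Type*} [Field F] [ValuativeRel F] [TopologicalSpace F] [IsNonarchimedeanLocalField F]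
  [MeasurableSpace F] [BorelSpace F]

/-- **Integrability of a shell-constant function supported in `𝒪_F`.** If `f : Fˣ → ℂ` is strongly
measurable, vanishes on `|x| > 1`, takes the value `w m` on the shell `|x| = q^{-m}` (`m ∈ ℕ`), and
`∑ ‖w m‖ < ∞`, then `f` is integrable for every left-invariant measure `μ'` finite on compacts:
`∫ ‖f‖ dμ' ≤ μ'(𝒪ˣ) ∑_m ‖w m‖` (Tate 1950, §2.5). [cite: Tate1950, §2.5] -/
theorem integrable_units_of_shell (μ' : Measure Fˣ) [IsFiniteMeasureOnCompacts μ']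
    [μ'.IsMulLeftInvariant] {f : Fˣ → ℂ} {w : ℕ → ℂ} (hfm : AEStronglyMeasurable f μ')
    (hf0 : ∀ x : Fˣ, 1 < normAbs F (x : F) → f x = 0)
    (hfv : ∀ (m : ℕ) (x : Fˣ), normAbs F (x : F) = ((residueFieldCard F : ℝ≥0)⁻¹) ^ (m : ℤ) → f x = w m)
    (hw : Summable fun m => ‖w m‖) :
    Integrable f μ' := by
  set S : ℕ → Set Fˣ := fun m => {x : Fˣ | normAbs F (x : F) = ((residueFieldCard F : ℝ≥0)⁻¹) ^ (m : ℤ)}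
    with hS
  have hSm : ∀ m, MeasurableSet (S m) := fun m => measurableSet_normAbs_shell (m : ℤ)
  have hSμ : ∀ m, μ' (S m) = μ' {x : Fˣ | valuation F (x : F) = 1} := fun m => measure_shell μ' (m : ℤ)
  have hfin : μ' {x : Fˣ | valuation F (x : F) = 1} < ∞ := measure_unitSphere_lt_top μ'
  have hdisj : ∀ m m' : ℕ, m ≠ m' → Disjoint (S m) (S m') := fun m m' h =>
    pairwise_disjoint_shell (F := F) (show (m : ℤ) ≠ m' by exact_mod_cast h)
  -- `‖f‖ₑ` is the pointwise sum of `‖w m‖ₑ 1_{S m}`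
  have hpt : ∀ x : Fˣ, ‖f x‖ₑ = ∑' m, (S m).indicator (fun _ => ‖w m‖ₑ) x := by
    intro x
    obtain ⟨k, hk⟩ := exists_normAbs_eq_inv_zpow x.ne_zero
    by_cases hk0 : 0 ≤ k
    · obtain ⟨m, rfl⟩ : ∃ m : ℕ, k = m := ⟨k.toNat, (Int.toNat_of_nonneg hk0).symm⟩
      have hxm : x ∈ S m := hk
      rw [tsum_eq_single m fun m' hm' => Set.indicator_of_notMem
        (fun h => (Set.disjoint_left.1 (hdisj m m' (Ne.symm hm')) hxm h)) _,
        Set.indicator_of_mem hxm, hfv m x hk]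
    · have hx1 : 1 < normAbs F (x : F) := by
        rw [hk, ← zpow_zero ((residueFieldCard F : ℝ≥0)⁻¹)]
        exact (zpow_right_strictAnti₀ inv_residueFieldCard_pos inv_residueFieldCard_lt_one)
          (lt_of_not_ge hk0)
      rw [hf0 x hx1, enorm_zero, eq_comm]
      have hzero : (fun m => (S m).indicator (fun _ => ‖w m‖ₑ) x) = fun _ => 0 := by
        funext m
        refine Set.indicator_of_notMem (fun hxm => ?_) _
        have h := inv_residueFieldCard_zpow_injective (hk.symm.trans hxm)
        omega
      rw [hzero, tsum_zero]
  refine ⟨hfm, ?_⟩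
  rw [HasFiniteIntegral, lintegral_congr hpt,
    lintegral_tsum fun m => (measurable_const.indicator (hSm m)).aemeasurable]
  have h1 : ∀ m, ∫⁻ x, (S m).indicator (fun _ => ‖w m‖ₑ) x ∂μ' = ‖w m‖ₑ * μ' {x : Fˣ | valuation F (x : F) = 1} := by
    intro m
    rw [lintegral_indicator_const (hSm m), hSμ m]
  simp_rw [h1]
  rw [ENNReal.tsum_mul_right]
  refine ENNReal.mul_lt_top ?_ hfin
  have hw' : Summable fun m => ‖w m‖₊ := NNReal.summable_coe.1 hw
  simpa only [enorm_eq_nnnorm] using (ENNReal.tsum_coe_ne_top_iff_summable.2 hw').lt_top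

end Shell

/-! ### 2. The unramified Hecke integral -/

section Spherical

variable {F : Type*} [Field F] [ValuativeRel F] [TopologicalSpace F] [IsNonarchimedeanLocalField F]
  {V : Type*} [AddCommGroup V] [Module ℂ V] (π : Representation ℂ (GL (Fin 2) F) V)

/-- **The torus generating series of a spherical Whittaker function of `GL₂`** (Shintani + Cauchy at
`(n, m) = (2, 1)` against the trivial representation of `GL₁`): for `|a q^{-s}| < 1` (`a ∈ α`),
`∑_m W°(diag(ϖ^m, 1)) (q^{1/2} q^{-s})^m = Λ(v) · (∏_{a ∈ α} (1 - a q^{-s}))⁻¹`.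
[cite: Shintani1976, Theorem] [cite: JacquetLanglands1970, Prop. 3.5] -/
theorem hasSum_whittakerModel_diagGL2_pow {ϖ : Fˣ} (hϖ : (valuation F).IsUniformizer (ϖ : F))
    {ψ : AddChar F Circle} (hψ0 : ψ.HasConductorExp 0) {Λ : Module.Dual ℂ V}
    (hΛ : Λ ∈ whittakerFunctionals π ψ) {v : V} (hv : v ∈ π.fixedPoints (glInt 2 F))
    {α : Multiset ℂ} {x : Fin 2 → ℂ} (hx : (univ : Finset (Fin 2)).val.map x = α)
    (hT : ∀ r, 1 ≤ r → r ≤ 2 → heckeT π ϖ r v =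
      ((((Real.sqrt (residueFieldCard F)) ^ (r * (2 - r)) : ℝ) : ℂ) * α.esymm r) • v)
    {s : ℂ} (hs : ∀ a ∈ α, ‖a * (residueFieldCard F : ℂ) ^ (-s)‖ < 1) :
    HasSum (fun m : ℕ => whittakerModel π Λ v (diagGL2 (ϖ ^ m) 1) *
        (((Real.sqrt (residueFieldCard F) : ℝ) : ℂ) * (residueFieldCard F : ℂ) ^ (-s)) ^ m)
      (Λ v * (((α.map fun a => (1 : ℂ[X]) - C a * X).prod).eval ((residueFieldCard F : ℂ) ^ (-s)))⁻¹) := by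
  classical
  have hϖu : IsUniformizingElement (ϖ : F) := isUniformizingElement_of_isUniformizer hϖ
  have hϖ0 : (ϖ : F) ≠ 0 := hϖu.ne_zero
  have hmk : Units.mk0 (ϖ : F) hϖ0 = ϖ := Units.mk0_val _ _
  set t : ℂ := (residueFieldCard F : ℂ) ^ (-s) with ht_def
  set sq : ℂ := ((Real.sqrt (residueFieldCard F) : ℝ) : ℂ) with hsq_def
  -- the trivial representation of `GL₁(F)` on `ℂ`: every vector is spherical with Satake parameter `{1}`
  set ρ' : Representation ℂ (GL (Fin 1) F) ℂ := Representation.trivial ℂ (GL (Fin 1) F) ℂ with hρ'_def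
  have hW' : ∀ g, whittakerModel ρ' (LinearMap.id : Module.Dual ℂ ℂ) 1 g = 1 := fun g =>
    whittakerModel_trivial_apply LinearMap.id 1 g
  have hΛ' : (LinearMap.id : Module.Dual ℂ ℂ) ∈ whittakerFunctionals ρ' ψ := by
    rw [whittakerFunctionals_eq_top_of_fin_one]; exact Submodule.mem_top
  have hv'fix : (1 : ℂ) ∈ ρ'.fixedPoints (glInt 1 F) := by
    rw [Representation.mem_fixedPoints]
    intro k _
    rw [hρ'_def, Representation.trivial_apply]
  have hy : (univ : Finset (Fin 1)).val.map (fun _ : Fin 1 => (1 : ℂ)) = ({1} : Multiset ℂ) := rfl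
  have hT' : ∀ r, 1 ≤ r → r ≤ 1 → heckeT ρ' (Units.mk0 (ϖ : F) hϖu.ne_zero) r (1 : ℂ) =
      ((((Real.sqrt (residueFieldCard F)) ^ (r * (1 - r)) : ℝ) : ℂ) * ({1} : Multiset ℂ).esymm r) • (1 : ℂ) := by
    intro r hr1 hr2
    obtain rfl : r = 1 := le_antisymm hr2 hr1
    rw [heckeT_self_apply _ _ hv'fix, hρ'_def, Representation.trivial_apply, Nat.sub_self, mul_zero,
      pow_zero, Complex.ofReal_one, one_mul, Multiset.esymm, Multiset.powersetCard_one,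
      Multiset.map_singleton, Multiset.map_singleton, Multiset.prod_singleton, Multiset.sum_singleton,
      one_smul]
  have hs' : ∀ a ∈ α, ∀ b ∈ ({1} : Multiset ℂ), ‖a * b * t‖ < 1 := by
    intro a ha b hb
    rw [Multiset.mem_singleton.1 hb, mul_one]
    exact hs a ha
  have hS := hasSum_whittakerModel_cornerTorus (Nat.one_lt_two).le π ρ' hϖu hψ0 hψ0 hΛ hΛ' hv hv'fix hx hy
    (fun r hr1 hr2 => by rw [hmk]; exact hT r hr1 hr2) hT' hs'
  have hpi : ∀ N : ℕ, piPowGL hϖu.ne_zero (fun _ : Fin 1 => N) = glDiagonal 1 F (fun _ => ϖ ^ N) := by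
    intro N
    rw [← glDiagonal_det_eq (piPowGL hϖu.ne_zero _), det_piPowGL_fin_one, hmk]
  convert hS using 1
  · funext N
    simp only [piAntidiag_univ_fin_one, Finset.sum_singleton, torusExponent_fin_one, zpow_zero, one_mul,
      hW', hpi, glCorner_one_eq_diagGL2, det_glDiagonal_fin_one, ← hsq_def, mul_pow,
      show (2 - 1) * N = N by omega, mul_one]
    ring
  · rw [satakePairPolynomial_singleton_one, LinearMap.id_apply, mul_one]

variable [MeasurableSpace F] [BorelSpace F]

/-- **Absolute convergence and value of the unramified local Hecke integral of `GL₂`.** With the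
notation of the file docstring, for every Haar measure `μ'` on `Fˣ` and `|a q^{-s}| < 1` (`a ∈ α`), the
function `a ↦ W°(diag(a,1)) |a|^{s-1/2}` is `μ'`-integrable and

  `∫_{Fˣ} W°(diag(a,1)) |a|^{s-1/2} dμ'(a) = μ'(𝒪ˣ) · Λ(v) · (∏_{a ∈ α} (1 - a q^{-s}))⁻¹`

— `W°(diag(a,1)) = 0` for `|a| > 1`, `W°(diag(ϖ^m u, 1)) = W°(diag(ϖ^m, 1))` for `u ∈ 𝒪ˣ`, the shells
`Fˣ = ⊔ ϖ^m 𝒪ˣ` and the torus generating series `hasSum_whittakerModel_diagGL2_pow`.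
[cite: JacquetLanglands1970, Prop. 3.5] [cite: CogdellAnalyticTheory2004, Thm. 3.3] -/
theorem integrable_and_integral_whittakerModel_diagGL2_mul_cpow {ϖ : Fˣ}
    (hϖ : (valuation F).IsUniformizer (ϖ : F))
    {ψ : AddChar F Circle} (hψ0 : ψ.HasConductorExp 0) {Λ : Module.Dual ℂ V}
    (hΛ : Λ ∈ whittakerFunctionals π ψ) {v : V} (hv : v ∈ π.fixedPoints (glInt 2 F))
    {α : Multiset ℂ} {x : Fin 2 → ℂ} (hx : (univ : Finset (Fin 2)).val.map x = α)
    (hT : ∀ r, 1 ≤ r → r ≤ 2 → heckeT π ϖ r v =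
      ((((Real.sqrt (residueFieldCard F)) ^ (r * (2 - r)) : ℝ) : ℂ) * α.esymm r) • v)
    (μ' : Measure Fˣ) [μ'.IsHaarMeasure]
    {s : ℂ} (hs : ∀ a ∈ α, ‖a * (residueFieldCard F : ℂ) ^ (-s)‖ < 1) :
    Integrable (fun a : Fˣ => whittakerModel π Λ v (diagGL2 a 1) *
        (((normAbs F (a : F) : ℝ≥0) : ℝ) : ℂ) ^ (s - 1 / 2)) μ' ∧
    ∫ a, whittakerModel π Λ v (diagGL2 a 1) * (((normAbs F (a : F) : ℝ≥0) : ℝ) : ℂ) ^ (s - 1 / 2) ∂μ' =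
      (μ' {x : Fˣ | valuation F (x : F) = 1}).toReal *
        (Λ v * (((α.map fun a => (1 : ℂ[X]) - C a * X).prod).eval ((residueFieldCard F : ℂ) ^ (-s)))⁻¹) := by
  classical
  haveI : T2Space F := (isLocalField F).toT2Space
  haveI : BorelSpace Fˣ := Units.borelSpace
  have hϖu : IsUniformizingElement (ϖ : F) := isUniformizingElement_of_isUniformizer hϖ
  have hϖn : normAbs F (ϖ : F) = (residueFieldCard F : ℝ≥0)⁻¹ := normAbs_uniformizer_holds hϖ
  set t : ℂ := (residueFieldCard F : ℂ) ^ (-s) with ht_def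
  set sq : ℂ := ((Real.sqrt (residueFieldCard F) : ℝ) : ℂ) with hsq_def
  -- the shell values and their generating series
  set w : ℕ → ℂ := fun m => whittakerModel π Λ v (diagGL2 (ϖ ^ m) 1) * (sq * t) ^ m with hw_def
  have hS : HasSum w (Λ v * (((α.map fun a => (1 : ℂ[X]) - C a * X).prod).eval t)⁻¹) :=
    hasSum_whittakerModel_diagGL2_pow π hϖ hψ0 hΛ hv hx hT hs
  have hsum : Summable fun m => ‖w m‖ := summable_norm_iff.2 hS.summable
  -- the shell description of the integrand
  have hr0 : (0 : ℝ) < (((residueFieldCard F : ℝ≥0)⁻¹ : ℝ≥0) : ℝ) := by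
    exact_mod_cast inv_residueFieldCard_pos (F := F)
  set f : Fˣ → ℂ := fun a => whittakerModel π Λ v (diagGL2 a 1) *
    (((normAbs F (a : F) : ℝ≥0) : ℝ) : ℂ) ^ (s - 1 / 2) with hf_def
  have hf0 : ∀ a : Fˣ, 1 < normAbs F (a : F) → f a = 0 := fun a ha => by
    simp only [hf_def]
    rw [whittakerModel_diagGL2_eq_zero_of_one_lt π hψ0 hΛ hv ha, zero_mul]
  have hfv : ∀ (m : ℕ) (a : Fˣ), normAbs F (a : F) = ((residueFieldCard F : ℝ≥0)⁻¹) ^ (m : ℤ) →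
      f a = w m := by
    intro m a ha
    set u : Fˣ := (ϖ ^ m)⁻¹ * a with hu_def
    have hau : a = ϖ ^ m * u := by rw [hu_def, mul_inv_cancel_left]
    have hu : valuation F (u : F) = 1 := by
      rw [← normAbs_eq_one_iff_valuation_eq_one, hu_def, Units.val_mul, Units.val_inv_eq_inv_val,
        Units.val_pow_eq_pow_val, map_mul, map_inv₀, map_pow, hϖn, ha, zpow_natCast, inv_mul_cancel₀]
      exact pow_ne_zero _ inv_residueFieldCard_pos.ne'
    have hWa : whittakerModel π Λ v (diagGL2 a 1) = whittakerModel π Λ v (diagGL2 (ϖ ^ m) 1) := by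
      rw [hau, whittakerModel_diagGL2_mul_of_valuation_eq_one π Λ hv _ hu]
    have habs : (((normAbs F (a : F) : ℝ≥0) : ℝ) : ℂ) ^ (s - 1 / 2) = (sq * t) ^ m := by
      rw [ha, NNReal.coe_zpow, ofReal_zpow_cpow hr0, inv_residueFieldCard_cpow_sub_one_half, zpow_natCast]
    simp only [hf_def, hw_def]
    rw [hWa, habs]
  -- measurability: `W°(diag(·,1))` is locally constant (`v` is smooth), `|·|^{s-1/2}` is continuous
  have hcont : Continuous f := by
    have h1 : Continuous fun a : Fˣ => whittakerModel π Λ v (diagGL2 a 1) :=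
      (isLocallyConstant_whittakerModel_diagGL2 π Λ
        (π.isSmoothVector_of_mem_fixedPoints (isOpen_glInt 2 F) hv)).continuous
    exact h1.mul ((isLocallyConstant_normAbs_units (F := F)).comp
      fun r : ℝ≥0 => ((r : ℝ) : ℂ) ^ (s - 1 / 2)).continuous
  refine ⟨integrable_units_of_shell μ' hcont.aestronglyMeasurable hf0 hfv hsum, ?_⟩
  rw [integral_units_eq_tsum_shell μ' hf0 hfv hsum, hS.tsum_eq]

end Spherical

end Literature.NumberTheory.Automorphic
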